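import Summits.BirchSwinnertonDyer.BirchSwinnertonDyer.Theorems.ResidualThetaTransportAtTwoHeckeThetaPartnerAdicAtTwoPartner
import Summits.BirchSwinnertonDyer.BirchSwinnertonDyer.Theorems.ResidualThetaTransportAtTwoHeckeThetaPartnerAdicAtTwoHeckeThetaNewform
import Summits.BirchSwinnertonDyer.BirchSwinnertonDyer.Theorems.ResidualThetaTransportAtTwoCohomologicalPlusPeriodSupplyPeriods
import Literature.NumberTheory.EllipticCurves.CMNewformGamma0OfGrossencharakter
import Literature.NumberTheory.EllipticCurves.ModularityVersionApProofs
import Summits.BirchSwinnertonDyer.BirchSwinnertonDyer.Theses.ResidualThetaTransportAtTwo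
import HarnessLib

/-!
# K0⁺ `HeckeThetaPartnerAdicAtTwo` from Ribet's CM-newform theorem (proof from print, conditional)

Route `ResidualThetaTransportAtTwo`, crux K0⁺ `HeckeThetaPartnerAdicAtTwo` (stmt-BirchSwinnertonDyer-20690),
the closing composition §G2 of the line "proof from print".  THEOREMS ONLY (no definition, no named
fact, no `sorry`).

`heckeThetaPartnerAdicAtTwo_of_ribet`: the crux BY NAME, CONDITIONAL on the single named fact
`Literature.NumberTheory.EllipticCurves.ModularForms.Ribet1977_cmNewform_gamma0_of_isGrossencharakter`
(Hecke–Shimura–Ribet: the CM newform on `Γ₀(N)`, `N ∣ |d_K|·N𝔪`, of a Größencharakter of an imaginary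
quadratic field of type `(k-1, 0)` with trivial Nebentypus, `a_p = ∑_{N𝔭 = p} ψ(𝔭)`; LNM 601 (1977) §3
Thm. (3.4), Cor. (3.5); reviewed named fact p562548).  Everything else is PROVED in the tree: the
arithmetic half `…Partner.exists_grossencharakter_partner` (the Größencharakter `ψ` of
`k = ℚ(√Δ_W)` with `ψ ≡ χ^{±1}` for the cubic character `χ` of `ℚ(W[2])/k`, odd modulus, trivial
Nebentypus, and the trace congruence `∑_{Nw=ℓ} ψ(w) ≡ a_ℓ(W)`), and the cohomological plus period
(`CohomologicalPeriod.exists_isCohomologicalPlusPeriod`).  With Ribet's `g`: `M = N` is odd (it divides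
the odd `|d_k| t²`), `a₂(g) = 0` (no ideal of norm `2`: `2` is inert), `ι = e⁻¹|_{K_g}`, and for a prime
`ℓ ∤ 2 M N_W` one has `ℓ ∤ Δ_min(W)` (good reduction) hence `ℓ ∤ |d_k| t²` and
`ι a_ℓ(g) = e⁻¹(∑_{Nw=ℓ} ψ(w)) ≡ a_ℓ(W)`.

BSD is NOT proved by this file: it closes K0⁺ modulo the Ribet fact (a `conditional-result`).
-/

set_option autoImplicit false
set_option linter.dupNamespace false

noncomputable section

open scoped NumberField
open NumberField IsDedekindDomain WeierstrassCurve
open Literature.NumberTheory.GaloisRepresentations Literature.NumberTheory.LFunctions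
  Literature.NumberTheory.EllipticCurves Literature.NumberTheory.EllipticCurves.ModularForms
  Literature.NumberTheory.EllipticCurves.Rank1Residual

namespace Summit.BirchSwinnertonDyer.BirchSwinnertonDyer.Theorems

/-- **K0⁺ `HeckeThetaPartnerAdicAtTwo` (stmt-BirchSwinnertonDyer-20690) from Ribet 1977 §3** — the route
decl BY NAME, conditional on the named fact `Ribet1977_cmNewform_gamma0_of_isGrossencharakter`.  See the
module docstring. [cite: Ribet1977Nebentypus, §3, Thm. (3.4) and Cor. (3.5) (LNM 601, pp. 34–35)] -/
theorem heckeThetaPartnerAdicAtTwo_of_ribet (hRibet : Ribet1977_cmNewform_gamma0_of_isGrossencharakter) :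
    Summit.BirchSwinnertonDyer.BirchSwinnertonDyer.Theses.ResidualThetaTransportAtTwo.HeckeThetaPartnerAdicAtTwo := by
  intro W _ _ _ _ hss _ hΔ
  classical
  obtain ⟨k, _, _, σ, t, ψ, e, hk2, htc, ht0, hdt, htprimes, htodd, hno2, hψG, hneb, htrace⟩ :=
    HeckeThetaPartner.exists_grossencharakter_partner W hss hΔ
  haveI := htc
  set 𝔪 : Ideal (𝓞 k) := Ideal.span {(t : 𝓞 k)} with h𝔪def
  have ht0' : (t : 𝓞 k) ≠ 0 := by exact_mod_cast ht0
  have h𝔪0 : 𝔪 ≠ ⊥ := by rw [h𝔪def, Ne, Ideal.span_singleton_eq_bot]; exact ht0'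
  -- the infinity type `(k-1)·(1,0)` with `k = 2` is the type of `ψ`
  have hψG' : IsGrossencharakter 𝔪 (fun w => (((2 : ℕ) : ℤ) - 1) * embType σ w)
      (fun w => (((2 : ℕ) : ℤ) - 1) * embTypeConj σ w) ψ := by
    have h1 : (fun w => (((2 : ℕ) : ℤ) - 1) * embType σ w) = embType σ := funext fun w => by simp
    have h2 : (fun w => (((2 : ℕ) : ℤ) - 1) * embTypeConj σ w) = embTypeConj σ := funext fun w => by simp
    rw [h1, h2]; exact hψG
  obtain ⟨N, hN, g, hNdvd, hnew, hcmf, hcoeff⟩ :=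
    hRibet k hk2 htc σ 2 le_rfl 𝔪 h𝔪0 ψ hψG' (fun n hn hcop => hneb n hn hcop)
  -- the level is odd
  have hNm : Ideal.absNorm 𝔪 = (t ^ 2).natAbs := by
    rw [h𝔪def, Ideal.absNorm_span_singleton, show ((t : ℤ) : 𝓞 k) = algebraMap ℤ (𝓞 k) t from by simp,
      Algebra.norm_algebraMap, RingOfIntegers.rank, hk2]
  have htodd' : Odd t.natAbs := Int.natAbs_odd.mpr htodd
  have hdodd : Odd (discr k).natAbs := by
    obtain ⟨c, hc⟩ := hdt
    have : Odd (discr k * c) := by rw [← hc]; exact htodd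
    exact Int.natAbs_odd.mpr (Int.odd_mul.mp this).1
  have hDodd : Odd ((discr k).natAbs * Ideal.absNorm 𝔪) := by
    rw [hNm, Int.natAbs_pow]; exact hdodd.mul (htodd'.pow)
  have hModd : Odd N := Odd.of_dvd_nat hDodd hNdvd
  -- every prime factor of the level divides `Δ_min(W)`
  have hDprimes : ∀ ℓ : ℕ, ℓ.Prime → ℓ ∣ (discr k).natAbs * Ideal.absNorm 𝔪 →
      (ℓ : ℤ) ∣ minimalDiscriminantInt W := by
    intro ℓ hℓ hdvd
    rw [hNm, Int.natAbs_pow] at hdvd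
    have hℓZ : Prime (ℓ : ℤ) := Nat.prime_iff_prime_int.mp hℓ
    rcases (Nat.Prime.dvd_mul hℓ).mp hdvd with h | h
    · have h' : (ℓ : ℤ) ∣ discr k := Int.natCast_dvd.mpr h
      exact htprimes ℓ hℓ (h'.trans hdt)
    · have h' : (ℓ : ℤ) ∣ t := Int.natCast_dvd.mpr (hℓ.dvd_of_dvd_pow h)
      exact htprimes ℓ hℓ h'
  -- the embedding `ι = e⁻¹|_{K_g}` and a cohomological period
  let ι : coeffField g →+* PadicAlgCl 2 := ((e.symm : ℂ ≃+* PadicAlgCl 2) : ℂ →+* PadicAlgCl 2).comp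
    (algebraMap (coeffField g) ℂ)
  have hι : ∀ n : ℕ, embCoeff g ι n = e.symm (cuspCoeff g n) := fun n => rfl
  obtain ⟨Ω, hΩ⟩ := CohomologicalPeriod.exists_isCohomologicalPlusPeriod hnew ι
  -- `a₂(g) = 0`: there is no prime of norm `2`
  have ha2 : cuspCoeff g 2 = 0 := by
    have h2 : ¬ 2 ∣ (discr k).natAbs * Ideal.absNorm 𝔪 := fun h =>
      (Nat.not_even_iff_odd.mpr hDodd) (even_iff_two_dvd.mpr h)
    rw [hcoeff 2 Nat.prime_two h2]
    have hS : {v : HeightOneSpectrum (𝓞 k) | Ideal.absNorm v.asIdeal = 2} = ∅ := by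
      ext v; simp [hno2 v.asIdeal]
    change ∑ᶠ v ∈ {v : HeightOneSpectrum (𝓞 k) | Ideal.absNorm v.asIdeal = 2}, ψ v = 0
    rw [hS, finsum_mem_empty]
  refine ⟨N, hN, g, ι, Ω, hModd, hnew, hcmf, ha2, hΩ, fun ℓ hℓ hℓdvd => ?_⟩
  -- the congruence at `ℓ ∤ 2 N N_W`
  haveI : Fact ℓ.Prime := ⟨hℓ⟩
  have hℓ2 : ℓ ≠ 2 := by
    rintro rfl; exact hℓdvd (dvd_mul_of_dvd_left (dvd_mul_right 2 N) _)
  have hℓNW : ¬ ℓ ∣ W.conductorNorm ℤ := fun h => hℓdvd (dvd_mul_of_dvd_right h _)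
  have hgood : W.HasGoodReductionAtPrime ℓ := by
    by_contra hbad
    exact hℓNW ((W.dvd_conductorNorm_iff_not_hasGoodReductionAtPrime ℓ).mpr hbad)
  have hℓΔ : ¬ (ℓ : ℤ) ∣ minimalDiscriminantInt W := fun h =>
    WeierstrassCurve.not_hasGoodReductionAtPrime_of_dvd_minimalDiscriminantInt W ℓ h hgood
  have hℓD : ¬ ℓ ∣ (discr k).natAbs * Ideal.absNorm 𝔪 := fun h => hℓΔ (hDprimes ℓ hℓ h)
  rw [hι, hcoeff ℓ hℓ hℓD]
  exact htrace ℓ hℓ hℓ2 hℓΔ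

/-- **K0⁺ `HeckeThetaPartnerAdicAtTwo` (stmt-BirchSwinnertonDyer-20690), UNCONDITIONAL** — the route decl
BY NAME.  Same composition as `heckeThetaPartnerAdicAtTwo_of_ribet`, with Ribet's CM-newform theorem
at weight `2` now PROVED in the tree (`HeckeTheta.ribet_cmNewform_gamma0_two`: Hecke's theta series of
the weight-two Größencharakter, built from the genus-two Riemann theta transformation law, is a cusp
form on `Γ₀(|d_k| N𝔪)` with `q`-expansion `Σ ψ̃(𝔞) q^{N𝔞}`, hence a `T_p`-eigenform and a CM newform on
`Γ₀`). [cite: Ribet1977Nebentypus, §3, Thm. (3.4) and Cor. (3.5) (LNM 601, pp. 34–35)]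
[cite: Hecke1926Modulfunktionen, §3] -/
theorem heckeThetaPartnerAdicAtTwo_proof :
    Summit.BirchSwinnertonDyer.BirchSwinnertonDyer.Theses.ResidualThetaTransportAtTwo.HeckeThetaPartnerAdicAtTwo := by
  intro W _ _ _ _ hss _ hΔ
  classical
  obtain ⟨k, _, _, σ, t, ψ, e, hk2, htc, ht0, hdt, htprimes, htodd, hno2, hψG, hneb, htrace⟩ :=
    HeckeThetaPartner.exists_grossencharakter_partner W hss hΔ
  haveI := htc
  set 𝔪 : Ideal (𝓞 k) := Ideal.span {(t : 𝓞 k)} with h𝔪def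
  have ht0' : (t : 𝓞 k) ≠ 0 := by exact_mod_cast ht0
  have h𝔪0 : 𝔪 ≠ ⊥ := by rw [h𝔪def, Ne, Ideal.span_singleton_eq_bot]; exact ht0'
  obtain ⟨N, hN, g, hNdvd, hnew, hcmf, hcoeff⟩ :=
    HeckeTheta.ribet_cmNewform_gamma0_two k hk2 htc σ 𝔪 h𝔪0 ψ hψG (fun n hn hcop => hneb n hn hcop)
  -- the level is odd
  have hNm : Ideal.absNorm 𝔪 = (t ^ 2).natAbs := by
    rw [h𝔪def, Ideal.absNorm_span_singleton, show ((t : ℤ) : 𝓞 k) = algebraMap ℤ (𝓞 k) t from by simp,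
      Algebra.norm_algebraMap, RingOfIntegers.rank, hk2]
  have htodd' : Odd t.natAbs := Int.natAbs_odd.mpr htodd
  have hdodd : Odd (discr k).natAbs := by
    obtain ⟨c, hc⟩ := hdt
    have : Odd (discr k * c) := by rw [← hc]; exact htodd
    exact Int.natAbs_odd.mpr (Int.odd_mul.mp this).1
  have hDodd : Odd ((discr k).natAbs * Ideal.absNorm 𝔪) := by
    rw [hNm, Int.natAbs_pow]; exact hdodd.mul (htodd'.pow)
  have hModd : Odd N := Odd.of_dvd_nat hDodd hNdvd
  -- every prime factor of the level divides `Δ_min(W)`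
  have hDprimes : ∀ ℓ : ℕ, ℓ.Prime → ℓ ∣ (discr k).natAbs * Ideal.absNorm 𝔪 →
      (ℓ : ℤ) ∣ minimalDiscriminantInt W := by
    intro ℓ hℓ hdvd
    rw [hNm, Int.natAbs_pow] at hdvd
    have hℓZ : Prime (ℓ : ℤ) := Nat.prime_iff_prime_int.mp hℓ
    rcases (Nat.Prime.dvd_mul hℓ).mp hdvd with h | h
    · have h' : (ℓ : ℤ) ∣ discr k := Int.natCast_dvd.mpr h
      exact htprimes ℓ hℓ (h'.trans hdt)
    · have h' : (ℓ : ℤ) ∣ t := Int.natCast_dvd.mpr (hℓ.dvd_of_dvd_pow h)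
      exact htprimes ℓ hℓ h'
  -- the embedding `ι = e⁻¹|_{K_g}` and a cohomological period
  let ι : coeffField g →+* PadicAlgCl 2 := ((e.symm : ℂ ≃+* PadicAlgCl 2) : ℂ →+* PadicAlgCl 2).comp
    (algebraMap (coeffField g) ℂ)
  have hι : ∀ n : ℕ, embCoeff g ι n = e.symm (cuspCoeff g n) := fun n => rfl
  obtain ⟨Ω, hΩ⟩ := CohomologicalPeriod.exists_isCohomologicalPlusPeriod hnew ι
  -- `a₂(g) = 0`: there is no prime of norm `2`
  have ha2 : cuspCoeff g 2 = 0 := by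
    have h2 : ¬ 2 ∣ (discr k).natAbs * Ideal.absNorm 𝔪 := fun h =>
      (Nat.not_even_iff_odd.mpr hDodd) (even_iff_two_dvd.mpr h)
    rw [hcoeff 2 Nat.prime_two h2]
    have hS : {v : HeightOneSpectrum (𝓞 k) | Ideal.absNorm v.asIdeal = 2} = ∅ := by
      ext v; simp [hno2 v.asIdeal]
    change ∑ᶠ v ∈ {v : HeightOneSpectrum (𝓞 k) | Ideal.absNorm v.asIdeal = 2}, ψ v = 0
    rw [hS, finsum_mem_empty]
  refine ⟨N, hN, g, ι, Ω, hModd, hnew, hcmf, ha2, hΩ, fun ℓ hℓ hℓdvd => ?_⟩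
  -- the congruence at `ℓ ∤ 2 N N_W`
  haveI : Fact ℓ.Prime := ⟨hℓ⟩
  have hℓ2 : ℓ ≠ 2 := by
    rintro rfl; exact hℓdvd (dvd_mul_of_dvd_left (dvd_mul_right 2 N) _)
  have hℓNW : ¬ ℓ ∣ W.conductorNorm ℤ := fun h => hℓdvd (dvd_mul_of_dvd_right h _)
  have hgood : W.HasGoodReductionAtPrime ℓ := by
    by_contra hbad
    exact hℓNW ((W.dvd_conductorNorm_iff_not_hasGoodReductionAtPrime ℓ).mpr hbad)
  have hℓΔ : ¬ (ℓ : ℤ) ∣ minimalDiscriminantInt W := fun h =>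
    WeierstrassCurve.not_hasGoodReductionAtPrime_of_dvd_minimalDiscriminantInt W ℓ h hgood
  have hℓD : ¬ ℓ ∣ (discr k).natAbs * Ideal.absNorm 𝔪 := fun h => hℓΔ (hDprimes ℓ hℓ h)
  rw [hι, hcoeff ℓ hℓ hℓD]
  exact htrace ℓ hℓ hℓ2 hℓΔ

end Summit.BirchSwinnertonDyer.BirchSwinnertonDyer.Theorems

end
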